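import Summits.KontsevichZagierPeriods.Zeta5Search.Families.DualSpanProdCoeffTwo
import Summits.KontsevichZagierPeriods.Zeta5Search.DexactDiagonalK1
import HarnessLib

/-!
# ζ(5) search — CONJECTURE D-exact holds on the WHOLE DIAGONAL: `|Q(n·1⁸)| = dualConstantTerm (n·1⁸)` for every `n`

HONEST FRAMING: systematic search; no irrationality claim unless certified.  Cell `pub-zeta5`, fam-tele g11,
2026-08-21.  An identity between integers for every `n` (the absolute value of Zudilin's leading coefficient
`Q n` of the totally symmetric Brown–Zudilin forms equals the constant term of P2 g6's dual-cell integrand,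
`Families/DualConstantTerm`); nothing about the arithmetic of `ζ(5)`; no record moves; no conjecture node is
used as a hypothesis.  P2 g6's conjecture nodes `LeadingCoeffIsDualConstantTerm` / `LeadingCoeffRateIsDualDecay`
quantify over ALL parameter vectors and are NOT discharged by this diagonal theorem.

Assembly of two tree files: the bridge `DualCT.dualConstantTerm_diag_eq_Fdiag` / `DualCT.dexact_diag_of_singleSum`
(`Families/DualSpanProdCoeffTwo`) and the kernel proof `singleSumIdentity_holds` of the single-sum identity K1
(`Zeta5Search/DexactDiagonalK1`, P2 g6 — fam-tele g11's branch (b): this file is fam-tele g11's F4 with that one import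
changed by the filing lane, as authorised in the 23:36Z request; `Fdiag_eq_Q`).  Standard axioms only.
-/

namespace Summit.KontsevichZagierPeriods.Zeta5Search.Families.Cellular.DualCT

open Literature.NumberTheory.Irrationality
open Summit.KontsevichZagierPeriods.Zeta5Search.DexactDiagonalWhipple (singleSumIdentity_holds Fdiag_eq_Q)

/-- **CONJECTURE D-exact on the whole diagonal, unconditionally:** `|Q(n·1⁸)| = dualConstantTerm (n·1⁸)` for every `n`. -/
theorem dexact_diag (n : ℕ) :
    |BrownZudilin2022.QOf (SymRay.aDiag n)| = dualConstantTerm (SymRay.aDiag n) :=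
  dexact_diag_of_singleSum singleSumIdentity_holds n

/-- The diagonal torus period (dual constant term) IS Zudilin's `Q n`: `dualConstantTerm (n·1⁸) = Q n`. -/
theorem dualConstantTerm_diag_eq_Q (n : ℕ) :
    dualConstantTerm (SymRay.aDiag n) = (BrownZudilin2022.Q n : ℤ) := by
  rw [dualConstantTerm_diag_eq_Fdiag, Fdiag_eq_Q]

end Summit.KontsevichZagierPeriods.Zeta5Search.Families.Cellular.DualCT
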